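import Summits.ResolutionOfSingularities.ResolutionOfSingularities.Theorems.FrobeniusLadderFInjectiveMacaulayficationCuspE8LineFiModel
import Summits.ResolutionOfSingularities.ResolutionOfSingularities.Theorems.FrobeniusLadderFInjectiveMacaulayficationZxyGradedFiModel
import HarnessLib

/-!
# CHART 137 (`U*`) OF THE f_cusp/𝔽₃ FAN IS THE CUSP-DEGENERATE E8-LINE, UP TO AN AFFINE CHANGE OF COORDINATES
# (crux `FrobeniusLadder.FInjectiveMacaulayfication` stmt-ResolutionOfSingularities-15315, chain w45a, hole #3β, road (β) of the (iv) memo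
# `L/res-L1-w45a-stub-2/SCOPING-fcusp-iv.md` §2 row U*; res-L1-w45a-plan-1 POINTER 2026-08-27T10:03:06Z «then `CuspE8LineChart137` (S)»;
# seat res-L1-w45a-stub-2)

[OURS · L1 W4.5a] AI-written; AI review is weaker than expert review. NOT a statement of any manuscript; no named fact.

Chart 137 of idea-2's fan `Σ = Σ₁ ∧ Σ₂` for `f_cusp = z² + w⁵ + x⁶ + y⁹` at `p = 3` (`L/res-L1-w45a-idea-2/r5/kh3cusp3.json`, key "3",
`move2_charts[137]`: rays `e_z, e_w, (2,1,5,2), (3,2,9,4)`, ray names `(a,b,c,d) = (z̃, w̃, e₁₁, e₁₀) = (X 0, X 1, X 2, X 3)`) has the chart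
equation `g' = 1 + c³ + b⁵cd² + a²c` and the bad centre `I_C̃″ = (a, b, c+1)`. Under the affine change of variables
`θ : (X 0, X 1, X 2, X 3) ↦ (X 3, X 2 + 1, X 1, X 0)` the cusp-degenerate E8-line `g = X 1³ + (X 1 − 1)(X 3² + X 0² X 2⁵)` of
`CuspE8LineData` / `CuspE8LineFiModel` (p516241) goes to `g'` — IN CHARACTERISTIC `3` (`(c+1)³ = c³ + 1`) — and its stratum `(X 1, X 2, X 3)` to
`(c+1, b, a)`:

* `exists_theta` — the `k`-algebra automorphism `θ` and its inverse on the variables (any field);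
* `theta_g` — `θ g = g'` (`char k = 3`);
* `exists_quotEquiv` — `e : k[X]/(g') ≃+* k[X]/(g)` with `e ā = x̄₃`, `e b̄ = x̄₂`, `e (c̄+1) = x̄₁`, `e d̄ = x̄₀`;
* `map_centre` — `e` maps the chart's bad centre `(ā, b̄, c̄+1)` onto the stratum ideal `(x̄₁, x̄₂, x̄₃)` (the form of `CuspE8LineFiModel.exists_eta`);
* `cuspE8LineChart137FiModel_char3` — COROLLARY: `Spec k[a,b,c,d]/(g')` has a proper birational model with domain stalks satisfying the
  crux clause at every point (`CuspE8LineFiModel.cuspE8LineFiModel_char3` transported along `Spec e`, `ZxyGradedFiModel.model_of_ringEquiv`).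

The GLUE step of the (iv) memo (§3) consumes `exists_quotEquiv` + `map_centre` (blow-up algebras along matched centres are isomorphic,
`ReesChartCongr` / `PointFixableTransport`). No definitions, no named facts. [folklore]
-/

set_option linter.dupNamespace false

noncomputable section

open MvPolynomial AlgebraicGeometry

namespace Summit.ResolutionOfSingularities.ResolutionOfSingularities.Theorems.FInjectiveMacaulayfication.CuspE8LineChart137

open Summit.ResolutionOfSingularities.ResolutionOfSingularities.Theorems.FInjectiveMacaulayfication

variable (k : Type) [Field k]

/-- **The affine change of variables `θ : (X 0, X 1, X 2, X 3) ↦ (X 3, X 2 + 1, X 1, X 0)`** is a `k`-algebra automorphism of `k[X₀,…,X₃]`,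
with inverse `(X 0, X 1, X 2, X 3) ↦ (X 3, X 2, X 1 − 1, X 0)`. [folklore] -/
theorem exists_theta : ∃ θ : MvPolynomial (Fin 4) k ≃ₐ[k] MvPolynomial (Fin 4) k,
    (θ (X 0) = X 3 ∧ θ (X 1) = X 2 + 1 ∧ θ (X 2) = X 1 ∧ θ (X 3) = X 0) ∧
    (θ.symm (X 0) = X 3 ∧ θ.symm (X 1) = X 2 ∧ θ.symm (X 2) = X 1 - 1 ∧ θ.symm (X 3) = X 0) := by
  let f : MvPolynomial (Fin 4) k →ₐ[k] MvPolynomial (Fin 4) k := MvPolynomial.aeval ![X 3, X 2 + 1, X 1, X 0]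
  let f' : MvPolynomial (Fin 4) k →ₐ[k] MvPolynomial (Fin 4) k := MvPolynomial.aeval ![X 3, X 2, X 1 - 1, X 0]
  have hf0 : f (X 0) = X 3 := MvPolynomial.aeval_X _ 0
  have hf1 : f (X 1) = X 2 + 1 := MvPolynomial.aeval_X _ 1
  have hf2 : f (X 2) = X 1 := MvPolynomial.aeval_X _ 2
  have hf3 : f (X 3) = X 0 := MvPolynomial.aeval_X _ 3
  have hg0 : f' (X 0) = X 3 := MvPolynomial.aeval_X _ 0
  have hg1 : f' (X 1) = X 2 := MvPolynomial.aeval_X _ 1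
  have hg2 : f' (X 2) = X 1 - 1 := MvPolynomial.aeval_X _ 2
  have hg3 : f' (X 3) = X 0 := MvPolynomial.aeval_X _ 3
  have hff' : f.comp f' = AlgHom.id k _ := MvPolynomial.algHom_ext fun i => by
    fin_cases i
    · show f (f' (X 0)) = X 0
      rw [hg0, hf3]
    · show f (f' (X 1)) = X 1
      rw [hg1, hf2]
    · show f (f' (X 2)) = X 2
      rw [hg2, map_sub, map_one, hf1, add_sub_cancel_right]
    · show f (f' (X 3)) = X 3
      rw [hg3, hf0]
  have hf'f : f'.comp f = AlgHom.id k _ := MvPolynomial.algHom_ext fun i => by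
    fin_cases i
    · show f' (f (X 0)) = X 0
      rw [hf0, hg3]
    · show f' (f (X 1)) = X 1
      rw [hf1, map_add, map_one, hg2, sub_add_cancel]
    · show f' (f (X 2)) = X 2
      rw [hf2, hg1]
    · show f' (f (X 3)) = X 3
      rw [hf3, hg0]
  exact ⟨AlgEquiv.ofAlgHom f f' hff' hf'f, ⟨hf0, hf1, hf2, hf3⟩, ⟨hg0, hg1, hg2, hg3⟩⟩

/-- **`θ g = g'` in characteristic `3`**: the cusp-degenerate E8-line goes to chart 137's equation (`(X 2 + 1)³ = X 2³ + 1`). [folklore] -/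
theorem theta_g [CharP k 3] (θ : MvPolynomial (Fin 4) k ≃ₐ[k] MvPolynomial (Fin 4) k)
    (h0 : θ (X 0) = X 3) (h1 : θ (X 1) = X 2 + 1) (h2 : θ (X 2) = X 1) (h3 : θ (X 3) = X 0)
    (g : MvPolynomial (Fin 4) k) (hg : g = X 1 ^ 3 + (X 1 - 1) * (X 3 ^ 2 + X 0 ^ 2 * X 2 ^ 5))
    (g' : MvPolynomial (Fin 4) k) (hg' : g' = 1 + X 2 ^ 3 + X 1 ^ 5 * X 2 * X 3 ^ 2 + X 0 ^ 2 * X 2) : θ g = g' := by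
  subst hg hg'
  have h3' : (3 : MvPolynomial (Fin 4) k) = 0 := by
    have := CharP.cast_eq_zero (MvPolynomial (Fin 4) k) 3
    simpa using this
  simp only [map_add, map_mul, map_pow, map_sub, map_one, h0, h1, h2, h3]
  linear_combination (X 2 ^ 2 + X 2) * h3'

/-- `θ` maps `(g)` onto `(g')`. [folklore] -/
theorem map_span_g [CharP k 3] (θ : MvPolynomial (Fin 4) k ≃ₐ[k] MvPolynomial (Fin 4) k)
    (h0 : θ (X 0) = X 3) (h1 : θ (X 1) = X 2 + 1) (h2 : θ (X 2) = X 1) (h3 : θ (X 3) = X 0)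
    (g : MvPolynomial (Fin 4) k) (hg : g = X 1 ^ 3 + (X 1 - 1) * (X 3 ^ 2 + X 0 ^ 2 * X 2 ^ 5))
    (g' : MvPolynomial (Fin 4) k) (hg' : g' = 1 + X 2 ^ 3 + X 1 ^ 5 * X 2 * X 3 ^ 2 + X 0 ^ 2 * X 2) :
    Ideal.span {g'} = (Ideal.span {g}).map (θ.toRingEquiv : MvPolynomial (Fin 4) k →+* MvPolynomial (Fin 4) k) := by
  rw [Ideal.map_span, Set.image_singleton]
  congr 2
  exact (theta_g k θ h0 h1 h2 h3 g hg g' hg').symm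

/-- **THE COORDINATE RING OF CHART 137 IS ISOMORPHIC TO THAT OF THE CUSP-DEGENERATE E8-LINE**, `char k = 3`: `e : k[X]/(g') ≃+* k[X]/(g)`
with `e ā = x̄₃`, `e b̄ = x̄₂`, `e (c̄ + 1) = x̄₁`, `e d̄ = x̄₀` (`(a,b,c,d) = (X 0,…,X 3)` on the left, `CuspE8LineData` variables on the right).
[folklore] -/
theorem exists_quotEquiv [CharP k 3] (g : MvPolynomial (Fin 4) k) (hg : g = X 1 ^ 3 + (X 1 - 1) * (X 3 ^ 2 + X 0 ^ 2 * X 2 ^ 5))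
    (g' : MvPolynomial (Fin 4) k) (hg' : g' = 1 + X 2 ^ 3 + X 1 ^ 5 * X 2 * X 3 ^ 2 + X 0 ^ 2 * X 2) :
    ∃ e : (MvPolynomial (Fin 4) k ⧸ Ideal.span {g'}) ≃+* (MvPolynomial (Fin 4) k ⧸ Ideal.span {g}),
      e (Ideal.Quotient.mk (Ideal.span {g'}) (X 0)) = Ideal.Quotient.mk (Ideal.span {g}) (X 3) ∧
      e (Ideal.Quotient.mk (Ideal.span {g'}) (X 1)) = Ideal.Quotient.mk (Ideal.span {g}) (X 2) ∧
      e (Ideal.Quotient.mk (Ideal.span {g'}) (X 2 + 1)) = Ideal.Quotient.mk (Ideal.span {g}) (X 1) ∧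
      e (Ideal.Quotient.mk (Ideal.span {g'}) (X 3)) = Ideal.Quotient.mk (Ideal.span {g}) (X 0) := by
  obtain ⟨θ, ⟨h0, h1, h2, h3⟩, ⟨h0', h1', h2', h3'⟩⟩ := exists_theta k
  refine ⟨(Ideal.quotientEquiv (Ideal.span {g}) (Ideal.span {g'}) θ.toRingEquiv (map_span_g k θ h0 h1 h2 h3 g hg g' hg')).symm,
    ?_, ?_, ?_, ?_⟩
  · rw [Ideal.quotientEquiv_symm_mk]
    exact congrArg _ h0'
  · rw [Ideal.quotientEquiv_symm_mk]
    exact congrArg _ h1'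
  · rw [Ideal.quotientEquiv_symm_mk]
    refine congrArg _ ?_
    show θ.symm (X 2 + 1) = X 1
    rw [map_add, map_one, h2', sub_add_cancel]
  · rw [Ideal.quotientEquiv_symm_mk]
    exact congrArg _ h3'

/-- **`e` maps chart 137's bad centre `(ā, b̄, c̄ + 1)` onto the stratum ideal `(x̄₁, x̄₂, x̄₃)`** of the cusp-degenerate E8-line (the
`{1,2,3}`-image form of `CuspE8LineFiModel.exists_eta` / `cuspE8Line_strongPlusStep_char3`). [folklore] -/
theorem map_centre (g g' : MvPolynomial (Fin 4) k)
    (e : (MvPolynomial (Fin 4) k ⧸ Ideal.span {g'}) ≃+* (MvPolynomial (Fin 4) k ⧸ Ideal.span {g}))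
    (he0 : e (Ideal.Quotient.mk (Ideal.span {g'}) (X 0)) = Ideal.Quotient.mk (Ideal.span {g}) (X 3))
    (he1 : e (Ideal.Quotient.mk (Ideal.span {g'}) (X 1)) = Ideal.Quotient.mk (Ideal.span {g}) (X 2))
    (he2 : e (Ideal.Quotient.mk (Ideal.span {g'}) (X 2 + 1)) = Ideal.Quotient.mk (Ideal.span {g}) (X 1)) :
    Ideal.map e (Ideal.span {Ideal.Quotient.mk (Ideal.span {g'}) (X 0), Ideal.Quotient.mk (Ideal.span {g'}) (X 1),
        Ideal.Quotient.mk (Ideal.span {g'}) (X 2 + 1)}) =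
      Ideal.span ((fun j : Fin 4 => Ideal.Quotient.mk (Ideal.span {g}) (MvPolynomial.X j)) ''
        ((({1, 2, 3} : Finset (Fin 4)) : Set (Fin 4)))) := by
  rw [Ideal.map_span]
  congr 1
  rw [Finset.coe_insert, Finset.coe_insert, Finset.coe_singleton, Set.image_insert_eq, Set.image_insert_eq, Set.image_singleton,
    Set.image_insert_eq, Set.image_insert_eq, Set.image_singleton, he0, he1, he2]
  ext y
  simp only [Set.mem_insert_iff, Set.mem_singleton_iff]
  tauto

/-- **CHART 137 OF THE f_cusp/𝔽₃ FAN HAS AN F-INJECTIVE MACAULAYFICATION, `char k = 3`**: `Spec k[a,b,c,d]/(1 + c³ + b⁵cd² + a²c)` has a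
proper birational model with domain stalks satisfying the crux clause at every point (the cusp-degenerate E8-line's weighted blow-up,
`CuspE8LineFiModel.cuspE8LineFiModel_char3`, transported along `Spec e`). [folklore] -/
theorem cuspE8LineChart137FiModel_char3 [CharP k 3] (g' : MvPolynomial (Fin 4) k)
    (hg' : g' = 1 + X 2 ^ 3 + X 1 ^ 5 * X 2 * X 3 ^ 2 + X 0 ^ 2 * X 2) :
    ∃ (X' : Scheme.{0}) (π : X' ⟶ Spec (.of (MvPolynomial (Fin 4) k ⧸ Ideal.span {g'}))), IsProper π ∧
      Literature.AlgebraicGeometry.Resolution.IsBirational π ∧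
      ∀ y : X', IsDomain (X'.presheaf.stalk y) ∧ ∀ d : ℕ, ringKrullDim (X'.presheaf.stalk y) = d →
        ∀ s : Fin d → X'.presheaf.stalk y, (Ideal.span (Set.range s)).radical.IsMaximal →
          RingTheory.Sequence.IsWeaklyRegular (X'.presheaf.stalk y) (List.ofFn s) ∧
          ∀ z : X'.presheaf.stalk y, (∃ e : ℕ, z ^ 3 ^ e ∈
              Ideal.span ((fun w : X'.presheaf.stalk y => w ^ 3 ^ e) ''
                (Ideal.span (Set.range s) : Set (X'.presheaf.stalk y)))) →
            z ∈ Ideal.span (Set.range s) := by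
  obtain ⟨e, -⟩ := exists_quotEquiv k _ rfl g' hg'
  exact ZxyGradedFiModel.model_of_ringEquiv 3 e (CuspE8LineFiModel.cuspE8LineFiModel_char3 k _ rfl)

end Summit.ResolutionOfSingularities.ResolutionOfSingularities.Theorems.FInjectiveMacaulayfication.CuspE8LineChart137

end
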